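import Mathlib.Algebra.MvPolynomial.PDeriv
import Literature.NumberTheory.EllipticCurves.GaloisAction
import Literature.NumberTheory.EllipticCurves.BSDSelmerSmithCasesProofs
import HarnessLib

/-!
# Fisher 2012: the family of elliptic curves `5`-congruent to a given one (the Hesse pencil of `X_E(5)`)

NAMED FACTS (two, published, with proofs in print) + definitions + proved transport lemmas, in topic
`NumberTheory/EllipticCurves`, namespace `Literature.NumberTheory.EllipticCurves.Fisher2012`.
Written for the cell `b2b-bsdres` (run/shared/lean/b2b/bsd-rank1-residual/), whose HONEST FRAMING
applies to its use there: the goal of that cell is to DELETE the COMBINATION-SHAPED residual classes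
for ALL analytic-rank `≤ 1` elliptic curves over `ℚ` — "full BSD formula for every rank `≤ 1` curve
in class C" assembled STRICTLY from published theorems — so that the rank-`≤ 1` remainder becomes
exactly the CONSTRUCTION-SHAPED classes, which are TYPED (missing-input `Prop`s), NOT attempted;
this is not "finishing BSD". Use in the cell: a SOURCE OF `5`-CONGRUENT PARTNERS for the per-curve
visibility certificates (`Rank1Residual/Typed/VisibilityCertificate*.lean`): the modular curve
`X_E(5)` is `ℙ¹` over `ℚ`, so every `E/ℚ` has infinitely many `5`-congruent partners, given by
explicit formulae; a partner of positive rank with agreeing local conditions makes `Ш(E)[5] ≠ 0`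
VISIBLE. The facts below replace, for such a partner, the trace/Sturm congruence certificate (which is
impractical at the conductors these partners have) by a theorem.

## The source (T. Fisher, *The Hessian of a genus one curve*, Proc. LMS (3) 104 (2012) 613–648)

§8 (the Hesse polynomials), case `n = 5`, verbatim:
"`𝔇(λ,μ) = λ¹² − 66c₄λ¹⁰μ² − 440c₆λ⁹μ³ − 1485c₄²λ⁸μ⁴ − 3168c₄c₆λ⁷μ⁵ + (5940c₄³ − 10560c₆²)λ⁶μ⁶
 − 4752c₄²c₆λ⁵μ⁷ − (66825c₄⁴ − 63360c₄c₆²)λ⁴μ⁸ − (142560c₄³c₆ − 140800c₆³)λ³μ⁹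
 − (133650c₄⁵ − 133056c₄²c₆²)λ²μ¹⁰ − (61560c₄⁴c₆ − 61440c₄c₆³)λμ¹¹
 + (91125c₄⁶ − 193536c₄³c₆² + 102400c₆⁴)μ¹²`", and "By (c4def) and (c6def) we have
`𝔠₄(λ,μ) = −1/((deg 𝔇)²((deg 𝔇)−1)²) · |∂²𝔇/∂λ², ∂²𝔇/∂λ∂μ; ∂²𝔇/∂λ∂μ, ∂²𝔇/∂μ²|` and
`𝔠₆(λ,μ) = 1/(deg 𝔇 · deg 𝔠₄) · |∂𝔇/∂λ, ∂𝔇/∂μ; ∂𝔠₄/∂λ, ∂𝔠₄/∂μ|`. The Hesse polynomials are related by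
`𝔠₄(λ,μ)³ − 𝔠₆(λ,μ)² = (c₄³ − c₆²) 𝔇(λ,μ)ⁿ`." (here `deg 𝔇 = 12`, `deg 𝔠₄ = 20`, `n = 5`).
Definition 13.1: "Elliptic curves `E` and `E'` defined over `K` are directly `n`-congruent if there is
an isomorphism of Galois modules `E[n] ≅ E'[n]` that respects the Weil pairing."
**Theorem 13.2.** "Let `n = 2, 3, 4, 5`. Let `E` be an elliptic curve over `K`,
`y² = x³ − 27c₄x − 54c₆`, and let `E_{λ,μ}` be the family of curves
`y² = x³ − 27𝔠₄(λ,μ)x − 54𝔠₆(λ,μ)` where the coefficients of the Hesse polynomials `𝔠₄(λ,μ)` and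
`𝔠₆(λ,μ)` are evaluated at `c₄, c₆ ∈ K`. Then an elliptic curve `E'` over `K` is directly
`n`-congruent to `E` if and only if it is isomorphic over `K` to `E_{λ,μ}` for some `λ, μ ∈ K`."
(`K` a field of characteristic `0`, §13; the formulae "were previously obtained by Rubin and Silverberg
[RubinSilverberg], … by a different method", ibid. §1 and Cor. 13.4.)

T. Fisher, *Invariant theory for the elliptic normal quintic, I. Twists of X(5)*, Math. Ann. 356
(2013) 589–616, Lemma 5.6 and **Theorem 5.8** (the curves INDIRECTLY `5`-congruent to `E`, i.e. via
`ψ : E[5] ≅ E'[5]` with `e₅(ψS,ψT) = e₅(S,T)²`, parametrised by `Y_E^{(2)}(5) ≅ ℙ¹`), verbatim: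
"`𝔇(λ,μ) = −(125c₄³ + 64c₆²)λ¹² − 1620c₄²c₆λ¹¹μ − 66(25c₄⁴ + 56c₄c₆²)λ¹⁰μ² − 220(11c₄³c₆ +
16c₆³)λ⁹μ³ + 1485(5c₄⁵ + 4c₄²c₆²)λ⁸μ⁴ + 792(53c₄⁴c₆ + 28c₄c₆³)λ⁷μ⁵ + 660(9c₄⁶ + 164c₄³c₆² +
16c₆⁴)λ⁶μ⁶ + 2376(19c₄⁵c₆ + 44c₄²c₆³)λ⁵μ⁷ + 495(27c₄⁷ + 104c₄⁴c₆² + 112c₄c₆⁴)λ⁴μ⁸ + 220(81c₄⁶c₆ +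
136c₄³c₆³ + 80c₆⁵)λ³μ⁹ − 594(9c₄⁸ − 32c₄⁵c₆² − 16c₄²c₆⁴)λ²μ¹⁰ − 60(135c₄⁷c₆ − 328c₄⁴c₆³ +
112c₄c₆⁵)λμ¹¹ − (729c₄⁹ + 108c₄⁶c₆² − 2896c₄³c₆⁴ + 1600c₆⁶)μ¹²`",
"`𝔠₄(λ,μ) = −1/(11²·12²)·|Hessian(𝔇)|` and `𝔠₆(λ,μ) = −1/(12·20)·|∂𝔇/∂λ, ∂𝔇/∂μ; ∂𝔠₄/∂λ, ∂𝔠₄/∂μ|`.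
These polynomials satisfy the relation `𝔠₄(λ,μ)³ − 𝔠₆(λ,μ)² = (c₄³−c₆²)² 𝔇(λ,μ)⁵`."
**Theorem 5.8.** "Let `E` be an elliptic curve over `K` with Weierstrass equation
`y² = x³ − 27c₄x − 54c₆`. Then the family of elliptic curves parametrised by `Y_E^{(2)}(5)` is
`E_{λ,μ} : y² = x³ − 12𝔠₄(λ,μ)x − 16𝔠₆(λ,μ)` where the coefficients of `𝔠₄(λ,μ)` and `𝔠₆(λ,μ)`
are evaluated at `c₄, c₆ ∈ K`." (Proof (i): "it follows that `E` and `E_{λ,μ}` are indirectly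
`5`-congruent" for every non-singular member.)

## Transcription

* The two dodecics are `hesseD5 c₄ c₆` and `hesseD5ind c₄ c₆ : MvPolynomial (Fin 2) ℚ` (variables
  `X 0 = λ`, `X 1 = μ`), written VERBATIM; the invariants `𝔠₄, 𝔠₆` are DEFINED from them by the
  printed Hessian/Jacobian determinants with Mathlib's `MvPolynomial.pderiv` (`hesseC4`, `hesseC6`,
  `hesseC4ind`, `hesseC6ind`) — nothing is expanded by hand. The pencil members are the Weierstrass
  curves `hessePencil5 c₄ c₆ l m = ⟨0,0,0, −27𝔠₄(l,m), −54𝔠₆(l,m)⟩` and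
  `hessePencil5ind c₄ c₆ l m = ⟨0,0,0, −12𝔠₄(l,m), −16𝔠₆(l,m)⟩`; Fisher's `E` is
  `c4c6Model c₄ c₆ = ⟨0,0,0,−27c₄,−54c₆⟩`.
* "`n`-congruent" (an isomorphism of Galois modules `E[5] ≅ E'[5]`) is spelled as everywhere in the
  tree (`KrausOesterle1992.prop4_torsionIso_of_congruences`, `GreenbergVatsal2000.thm14_…`,
  `WeierstrassCurve.exists_sha_ne_zero_of_congr_of_index_lt`): a `Γ_ℚ`-equivariant additive
  equivalence `geomTorsion E' 5 ≃+ geomTorsion E 5`. The Weil-pairing clauses ("directly",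
  "indirectly") are DROPPED from the conclusions — weaker than print, which is all the visibility
  consumers use. Only the direction "every non-singular member of the family is `5`-congruent to `E`"
  (13.2 "if"; 5.8 (i)) is stated. `K = ℚ` only.
  `-- TODO(general form): any field of characteristic 0; the converse directions; the Weil pairing.`
* PROVED here (no fact): `exists_variableChange_eq_c4c6Model` — every `W/ℚ` is `ℚ`-isomorphic to
  `c4c6Model W.c₄ W.c₆` (Silverman AEC III §1, the substitution giving `y² = x³ − 27c₄x − 54c₆`), so
  the facts transport to ANY model: `fiveCongruent_hessePencil5` / `fiveCongruent_hessePencil5ind`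
  give `geomTorsion (pencil member) 5 ≃+ geomTorsion W 5`, equivariant, for every elliptic `W/ℚ`.
* Sanity of the transcription (outside the kernel, PARI/GP, cell job ids in
  `run/shared/lean/b2b/bsd-rank1-residual/b2b-bsdres-x11a/REPORT-g11.md`): both syzygies hold
  identically in `ℤ[c₄,c₆,λ,μ]`; `𝔠₄(1,0) = c₄`, `𝔠₆(1,0) = c₆` (so `E_{1,0} = E`); Fisher's
  Example 5.9 (`2834c1 → 2834d1` in the indirect family) is reproduced; every partner used by the
  cell passes `a_ℓ(E) ≡ a_ℓ(E_{λ,μ}) (mod 5)` at all good `ℓ ≤ 2000`.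

## References

* T. Fisher, Proc. LMS (3) 104 (2012) 613–648, §8, Def. 13.1, Thm. 13.2, Cor. 13.4. [Fisher2012Hessian]
* T. Fisher, Math. Ann. 356 (2013) 589–616, Lemma 5.6, Thm. 5.8, Ex. 5.9. [Fisher2013QuinticTwists]
* K. Rubin, A. Silverberg, *Families of elliptic curves with constant mod p representations* (1995)
  [RubinSilverberg1995]; A. Silverberg, in Cornell–Silverman–Stevens (1997), Thm. 2.1, §3
  [SilverbergCSS1997]; K. Rubin, ibid., Prop. 11 [RubinCSS1997].
* J. H. Silverman, AEC, III §1 (`c₄`, `c₆`, `y² = x³ − 27c₄x − 54c₆`). [SilvermanAEC2009]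
-/

noncomputable section

open scoped Classical

open MvPolynomial WeierstrassCurve

namespace Literature.NumberTheory.EllipticCurves.Fisher2012

/-! ### The Hesse polynomials for `n = 5` (Fisher 2012 §8) -/

/-- Fisher's dodecic `𝔇(λ,μ)` for `n = 5` (Proc. LMS 104 (2012), §8, the fourth displayed `𝔇`),
with `X 0 = λ`, `X 1 = μ`, coefficients evaluated at `c₄, c₆ ∈ ℚ`; its roots are the twelve cusps of
`X_E(5)`. [cite: Fisher2012Hessian, §8 (Hesse polynomials, case n = 5)] -/
def hesseD5 (c₄ c₆ : ℚ) : MvPolynomial (Fin 2) ℚ :=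
  X 0 ^ 12 - C (66 * c₄) * X 0 ^ 10 * X 1 ^ 2 - C (440 * c₆) * X 0 ^ 9 * X 1 ^ 3
    - C (1485 * c₄ ^ 2) * X 0 ^ 8 * X 1 ^ 4 - C (3168 * c₄ * c₆) * X 0 ^ 7 * X 1 ^ 5
    + C (5940 * c₄ ^ 3 - 10560 * c₆ ^ 2) * X 0 ^ 6 * X 1 ^ 6
    - C (4752 * c₄ ^ 2 * c₆) * X 0 ^ 5 * X 1 ^ 7
    - C (66825 * c₄ ^ 4 - 63360 * c₄ * c₆ ^ 2) * X 0 ^ 4 * X 1 ^ 8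
    - C (142560 * c₄ ^ 3 * c₆ - 140800 * c₆ ^ 3) * X 0 ^ 3 * X 1 ^ 9
    - C (133650 * c₄ ^ 5 - 133056 * c₄ ^ 2 * c₆ ^ 2) * X 0 ^ 2 * X 1 ^ 10
    - C (61560 * c₄ ^ 4 * c₆ - 61440 * c₄ * c₆ ^ 3) * X 0 * X 1 ^ 11
    + C (91125 * c₄ ^ 6 - 193536 * c₄ ^ 3 * c₆ ^ 2 + 102400 * c₆ ^ 4) * X 1 ^ 12

/-- The Hessian determinant `|∂²D/∂λ², ∂²D/∂λ∂μ; ∂²D/∂λ∂μ, ∂²D/∂μ²|` of a binary form `D`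
(variables `X 0, X 1`). [cite: Fisher2012Hessian, §8 (display defining 𝔠₄)] -/
def hessianDet (D : MvPolynomial (Fin 2) ℚ) : MvPolynomial (Fin 2) ℚ :=
  pderiv 0 (pderiv 0 D) * pderiv 1 (pderiv 1 D) - pderiv 0 (pderiv 1 D) ^ 2

/-- The Jacobian determinant `|∂D/∂λ, ∂D/∂μ; ∂C/∂λ, ∂C/∂μ|` of two binary forms.
[cite: Fisher2012Hessian, §8 (display defining 𝔠₆)] -/
def jacobianDet (D C' : MvPolynomial (Fin 2) ℚ) : MvPolynomial (Fin 2) ℚ :=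
  pderiv 0 D * pderiv 1 C' - pderiv 1 D * pderiv 0 C'

/-- Fisher's `𝔠₄(λ,μ) = −(1/(12²·11²)) · |Hessian(𝔇)|` for `n = 5` (`deg 𝔇 = 12`).
[cite: Fisher2012Hessian, §8 (display defining 𝔠₄, deg 𝔇 = 12)] -/
def hesseC4 (c₄ c₆ : ℚ) : MvPolynomial (Fin 2) ℚ :=
  C (-1 / (12 ^ 2 * 11 ^ 2 : ℚ)) * hessianDet (hesseD5 c₄ c₆)

/-- Fisher's `𝔠₆(λ,μ) = (1/(12·20)) · |∂𝔇/∂λ, ∂𝔇/∂μ; ∂𝔠₄/∂λ, ∂𝔠₄/∂μ|` for `n = 5`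
(`deg 𝔇 = 12`, `deg 𝔠₄ = 20`). [cite: Fisher2012Hessian, §8 (display defining 𝔠₆)] -/
def hesseC6 (c₄ c₆ : ℚ) : MvPolynomial (Fin 2) ℚ :=
  C (1 / (12 * 20 : ℚ)) * jacobianDet (hesseD5 c₄ c₆) (hesseC4 c₄ c₆)

/-- Fisher's `E`: the Weierstrass equation `y² = x³ − 27c₄x − 54c₆` (Silverman AEC III §1).
[cite: Fisher2012Hessian, Thm. 13.2 (the curve E)] -/
def c4c6Model (c₄ c₆ : ℚ) : WeierstrassCurve ℚ :=
  ⟨0, 0, 0, -27 * c₄, -54 * c₆⟩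

/-- The member `E_{λ,μ} : y² = x³ − 27𝔠₄(λ,μ)x − 54𝔠₆(λ,μ)` of the Hesse pencil of
`E : y² = x³ − 27c₄x − 54c₆` (the family parametrised by `X_E(5) ≅ ℙ¹`), at `(λ, μ) = (l, m)`.
[cite: Fisher2012Hessian, Thm. 13.2 (the family E_{λ,μ})] -/
def hessePencil5 (c₄ c₆ l m : ℚ) : WeierstrassCurve ℚ :=
  ⟨0, 0, 0, -27 * MvPolynomial.eval ![l, m] (hesseC4 c₄ c₆),
    -54 * MvPolynomial.eval ![l, m] (hesseC6 c₄ c₆)⟩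

/-! ### The indirect family (Fisher 2013, Lemma 5.6 / Theorem 5.8) -/

/-- Fisher's dodecic `𝔇(λ,μ)` of Lemma 5.6 (Math. Ann. 356 (2013)), case `r = 2` (curves INDIRECTLY
`5`-congruent to `E`), `X 0 = λ`, `X 1 = μ`. [cite: Fisher2013QuinticTwists, Lemma 5.6 (display for 𝔇(λ,μ))] -/
def hesseD5ind (c₄ c₆ : ℚ) : MvPolynomial (Fin 2) ℚ :=
  - C (125 * c₄ ^ 3 + 64 * c₆ ^ 2) * X 0 ^ 12 - C (1620 * c₄ ^ 2 * c₆) * X 0 ^ 11 * X 1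
    - C (66 * (25 * c₄ ^ 4 + 56 * c₄ * c₆ ^ 2)) * X 0 ^ 10 * X 1 ^ 2
    - C (220 * (11 * c₄ ^ 3 * c₆ + 16 * c₆ ^ 3)) * X 0 ^ 9 * X 1 ^ 3
    + C (1485 * (5 * c₄ ^ 5 + 4 * c₄ ^ 2 * c₆ ^ 2)) * X 0 ^ 8 * X 1 ^ 4
    + C (792 * (53 * c₄ ^ 4 * c₆ + 28 * c₄ * c₆ ^ 3)) * X 0 ^ 7 * X 1 ^ 5
    + C (660 * (9 * c₄ ^ 6 + 164 * c₄ ^ 3 * c₆ ^ 2 + 16 * c₆ ^ 4)) * X 0 ^ 6 * X 1 ^ 6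
    + C (2376 * (19 * c₄ ^ 5 * c₆ + 44 * c₄ ^ 2 * c₆ ^ 3)) * X 0 ^ 5 * X 1 ^ 7
    + C (495 * (27 * c₄ ^ 7 + 104 * c₄ ^ 4 * c₆ ^ 2 + 112 * c₄ * c₆ ^ 4)) * X 0 ^ 4 * X 1 ^ 8
    + C (220 * (81 * c₄ ^ 6 * c₆ + 136 * c₄ ^ 3 * c₆ ^ 3 + 80 * c₆ ^ 5)) * X 0 ^ 3 * X 1 ^ 9
    - C (594 * (9 * c₄ ^ 8 - 32 * c₄ ^ 5 * c₆ ^ 2 - 16 * c₄ ^ 2 * c₆ ^ 4)) * X 0 ^ 2 * X 1 ^ 10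
    - C (60 * (135 * c₄ ^ 7 * c₆ - 328 * c₄ ^ 4 * c₆ ^ 3 + 112 * c₄ * c₆ ^ 5)) * X 0 * X 1 ^ 11
    - C (729 * c₄ ^ 9 + 108 * c₄ ^ 6 * c₆ ^ 2 - 2896 * c₄ ^ 3 * c₆ ^ 4 + 1600 * c₆ ^ 6)
        * X 1 ^ 12

/-- `𝔠₄(λ,μ) = −(1/(11²·12²)) · |Hessian(𝔇)|` of the indirect family.
[cite: Fisher2013QuinticTwists, Lemma 5.6 (display defining 𝔠₄)] -/
def hesseC4ind (c₄ c₆ : ℚ) : MvPolynomial (Fin 2) ℚ :=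
  C (-1 / (11 ^ 2 * 12 ^ 2 : ℚ)) * hessianDet (hesseD5ind c₄ c₆)

/-- `𝔠₆(λ,μ) = −(1/(12·20)) · |∂𝔇/∂λ, ∂𝔇/∂μ; ∂𝔠₄/∂λ, ∂𝔠₄/∂μ|` of the indirect family.
[cite: Fisher2013QuinticTwists, Lemma 5.6 (display defining 𝔠₆)] -/
def hesseC6ind (c₄ c₆ : ℚ) : MvPolynomial (Fin 2) ℚ :=
  C (-1 / (12 * 20 : ℚ)) * jacobianDet (hesseD5ind c₄ c₆) (hesseC4ind c₄ c₆)

/-- The member `E_{λ,μ} : y² = x³ − 12𝔠₄(λ,μ)x − 16𝔠₆(λ,μ)` of the family parametrised by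
`Y_E^{(2)}(5)` (curves indirectly `5`-congruent to `E : y² = x³ − 27c₄x − 54c₆`).
[cite: Fisher2013QuinticTwists, Thm. 5.8 (the family E_{λ,μ})] -/
def hessePencil5ind (c₄ c₆ l m : ℚ) : WeierstrassCurve ℚ :=
  ⟨0, 0, 0, -12 * MvPolynomial.eval ![l, m] (hesseC4ind c₄ c₆),
    -16 * MvPolynomial.eval ![l, m] (hesseC6ind c₄ c₆)⟩

/-! ### The named facts -/

/-- **Fisher 2012, Theorem 13.2, direction "if", `n = 5`, `K = ℚ`** (formulae of Rubin–Silverberg):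
every NON-SINGULAR member `E_{λ,μ}` (`λ, μ ∈ ℚ`) of the Hesse pencil of the elliptic curve
`E : y² = x³ − 27c₄x − 54c₆` is `5`-congruent to `E` — there is an isomorphism of `Γ_ℚ`-modules
`E_{λ,μ}[5] ≅ E[5]` (print: "directly `5`-congruent", i.e. moreover respecting the Weil pairing; that
clause is dropped). NAMED FACT, not proved here. [cite: Fisher2012Hessian, Thm. 13.2 (with §8 and Def. 13.1)] -/
def thm132_fiveCongruent_hessePencil : Prop :=
  ∀ (c₄ c₆ l m : ℚ) [(c4c6Model c₄ c₆).IsElliptic] [(hessePencil5 c₄ c₆ l m).IsElliptic],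
    ∃ e : geomTorsion (hessePencil5 c₄ c₆ l m) (5 : ℤ) ≃+ geomTorsion (c4c6Model c₄ c₆) (5 : ℤ),
      ∀ (σ : Field.absoluteGaloisGroup ℚ) (P : geomTorsion (hessePencil5 c₄ c₆ l m) (5 : ℤ)),
        e (σ • P) = σ • e P

/-- **Fisher 2013, Theorem 5.8 (i), `K = ℚ`**: every NON-SINGULAR member
`E_{λ,μ} : y² = x³ − 12𝔠₄(λ,μ)x − 16𝔠₆(λ,μ)` (`λ, μ ∈ ℚ`) of the family parametrised by
`Y_E^{(2)}(5)` is `5`-congruent to `E : y² = x³ − 27c₄x − 54c₆` — there is an isomorphism of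
`Γ_ℚ`-modules `E_{λ,μ}[5] ≅ E[5]` (print: "indirectly `5`-congruent", i.e. multiplying the Weil
pairing by the non-square `2`; that clause is dropped). NAMED FACT, not proved here.
[cite: Fisher2013QuinticTwists, Thm. 5.8 (with Lemma 5.6 and Def. 5.1)] -/
def thm58_fiveCongruent_hessePencilInd : Prop :=
  ∀ (c₄ c₆ l m : ℚ) [(c4c6Model c₄ c₆).IsElliptic] [(hessePencil5ind c₄ c₆ l m).IsElliptic],
    ∃ e : geomTorsion (hessePencil5ind c₄ c₆ l m) (5 : ℤ) ≃+ geomTorsion (c4c6Model c₄ c₆) (5 : ℤ),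
      ∀ (σ : Field.absoluteGaloisGroup ℚ) (P : geomTorsion (hessePencil5ind c₄ c₆ l m) (5 : ℤ)),
        e (σ • P) = σ • e P

/-! ### Proved: the `c₄, c₆`-model and transport to an arbitrary model -/

/-- **Silverman AEC III §1**: every Weierstrass curve `W/ℚ` is carried by the admissible change of
variables `u = 1/6`, `r = −b₂/12`, `s = −a₁/2`, `t = −(a₃ − a₁b₂/12)/2` to the equation
`y² = x³ − 27c₄x − 54c₆` with `c₄ = c₄(W)`, `c₆ = c₆(W)`. Proved by computation.
[cite: SilvermanAEC2009, III §1 (the equation y² = x³ − 27c₄x − 54c₆)] -/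
theorem exists_variableChange_eq_c4c6Model (W : WeierstrassCurve ℚ) :
    ∃ C : VariableChange ℚ, C • W = c4c6Model W.c₄ W.c₆ := by
  refine ⟨⟨Units.mk0 (1 / 6 : ℚ) (by norm_num), -W.b₂ / 12, -W.a₁ / 2,
    -(W.a₃ - W.b₂ / 12 * W.a₁) / 2⟩, ?_⟩
  have hu : ((Units.mk0 (1 / 6 : ℚ) (by norm_num))⁻¹ : ℚˣ) = (6 : ℚ) := by
    rw [Units.val_inv_eq_inv_val, Units.val_mk0]; norm_num
  ext
  · rw [variableChange_a₁, hu]; simp only [c4c6Model]; ring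
  · rw [variableChange_a₂, hu]; simp only [c4c6Model, WeierstrassCurve.b₂]; ring
  · rw [variableChange_a₃, hu]; simp only [c4c6Model]; ring
  · rw [variableChange_a₄, hu]
    simp only [c4c6Model, WeierstrassCurve.c₄, WeierstrassCurve.b₂, WeierstrassCurve.b₄]; ring
  · rw [variableChange_a₆, hu]
    simp only [c4c6Model, WeierstrassCurve.c₆, WeierstrassCurve.b₂, WeierstrassCurve.b₄,
      WeierstrassCurve.b₆]
    ring

/-- The `c₄, c₆`-model of an elliptic curve is an elliptic curve (it is `ℚ`-isomorphic to it).
[cite: SilvermanAEC2009, III §1] -/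
instance isElliptic_c4c6Model (W : WeierstrassCurve ℚ) [W.IsElliptic] :
    (c4c6Model W.c₄ W.c₆).IsElliptic := by
  obtain ⟨C, hC⟩ := exists_variableChange_eq_c4c6Model W
  rw [← hC]
  infer_instance

/-- `W[5] ≅ (c₄,c₆-model of W)[5]`, `Γ_ℚ`-equivariantly (change of variables; proved).
[cite: SilvermanAEC2009, III §1] -/
theorem exists_geomTorsion_addEquiv_c4c6Model (W : WeierstrassCurve ℚ) (n : ℤ) :
    ∃ e : geomTorsion W n ≃+ geomTorsion (c4c6Model W.c₄ W.c₆) n,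
      ∀ (σ : Field.absoluteGaloisGroup ℚ) (P : geomTorsion W n), e (σ • P) = σ • e P := by
  obtain ⟨C, hC⟩ := exists_variableChange_eq_c4c6Model W
  rw [← hC]
  exact W.exists_geomTorsion_addEquiv_smul C n

/-- **Transport of Theorem 13.2 to any model.** For every elliptic curve `W/ℚ` and every
non-singular member of the Hesse pencil of its `c₄,c₆`-model, `E_{λ,μ}[5] ≅ W[5]` as `Γ_ℚ`-modules.
Conditional on the named fact `thm132_fiveCongruent_hessePencil`; the transport along
`W ≅ c4c6Model W.c₄ W.c₆` is proved. [cite: Fisher2012Hessian, Thm. 13.2] -/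
theorem fiveCongruent_hessePencil5 (hF : thm132_fiveCongruent_hessePencil)
    (W : WeierstrassCurve ℚ) [W.IsElliptic] (l m : ℚ) [(hessePencil5 W.c₄ W.c₆ l m).IsElliptic] :
    ∃ e : geomTorsion (hessePencil5 W.c₄ W.c₆ l m) (5 : ℤ) ≃+ geomTorsion W (5 : ℤ),
      ∀ (σ : Field.absoluteGaloisGroup ℚ) (P : geomTorsion (hessePencil5 W.c₄ W.c₆ l m) (5 : ℤ)),
        e (σ • P) = σ • e P := by
  obtain ⟨e₁, he₁⟩ := hF W.c₄ W.c₆ l m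
  obtain ⟨e₂, he₂⟩ := exists_geomTorsion_addEquiv_c4c6Model W 5
  refine ⟨e₁.trans e₂.symm, fun σ P => ?_⟩
  simp only [AddEquiv.trans_apply]
  apply e₂.injective
  rw [AddEquiv.apply_symm_apply, he₂, AddEquiv.apply_symm_apply, he₁]

/-- **Transport of Theorem 5.8 (i) to any model.** For every elliptic curve `W/ℚ` and every
non-singular member of the indirect family of its `c₄,c₆`-model, `E_{λ,μ}[5] ≅ W[5]` as
`Γ_ℚ`-modules. Conditional on the named fact `thm58_fiveCongruent_hessePencilInd`.
[cite: Fisher2013QuinticTwists, Thm. 5.8] -/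
theorem fiveCongruent_hessePencil5ind (hF : thm58_fiveCongruent_hessePencilInd)
    (W : WeierstrassCurve ℚ) [W.IsElliptic] (l m : ℚ) [(hessePencil5ind W.c₄ W.c₆ l m).IsElliptic] :
    ∃ e : geomTorsion (hessePencil5ind W.c₄ W.c₆ l m) (5 : ℤ) ≃+ geomTorsion W (5 : ℤ),
      ∀ (σ : Field.absoluteGaloisGroup ℚ) (P : geomTorsion (hessePencil5ind W.c₄ W.c₆ l m) (5 : ℤ)),
        e (σ • P) = σ • e P := by
  obtain ⟨e₁, he₁⟩ := hF W.c₄ W.c₆ l m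
  obtain ⟨e₂, he₂⟩ := exists_geomTorsion_addEquiv_c4c6Model W 5
  refine ⟨e₁.trans e₂.symm, fun σ P => ?_⟩
  simp only [AddEquiv.trans_apply]
  apply e₂.injective
  rw [AddEquiv.apply_symm_apply, he₂, AddEquiv.apply_symm_apply, he₁]

/-! ### Appendix (x11a gen 11, second instalment): the case `n = 3` of Theorem 13.2

Fisher 2012 §8, the second displayed Hesse polynomial: "`𝔇(λ,μ) = λ⁴ − 6c₄λ²μ² − 8c₆λμ³ − 3c₄²μ⁴`"
(`n = 3`, `deg 𝔇 = 4`, `deg 𝔠₄ = 4n/(6−n) = 4`), with the same displays for `𝔠₄ = −|H(𝔇)|/(4²·3²)`,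
`𝔠₆ = |J(𝔇, 𝔠₄)|/(4·4)`, `𝔠₄³ − 𝔠₆² = (c₄³ − c₆²)𝔇³`, and Theorem 13.2 for `n = 3` (the twist
`X_E(3) ≅ ℙ¹`; "our formulae in the case `n = 3` were already known to Salmon"). Stated for the cell's
`p = 3` visibility certificates (X11 at `p = 3`, X6/X7/X8: `Typed/VisibilityCertificateMultiplicative.lean`,
module docstring: 31 rank-`0` pairs with `9 ‖ #Ш_an` below `2·10⁴` without a usable partner in the
database). Same transcription rules as above (Galois-module isomorphism only, `K = ℚ`, direction "if"). -/

/-- Fisher's quartic `𝔇(λ,μ) = λ⁴ − 6c₄λ²μ² − 8c₆λμ³ − 3c₄²μ⁴` for `n = 3` (Proc. LMS 104 (2012), §8,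
the second displayed `𝔇`), `X 0 = λ`, `X 1 = μ`. [cite: Fisher2012Hessian, §8 (Hesse polynomials, case n = 3)] -/
def hesseD3 (c₄ c₆ : ℚ) : MvPolynomial (Fin 2) ℚ :=
  X 0 ^ 4 - C (6 * c₄) * X 0 ^ 2 * X 1 ^ 2 - C (8 * c₆) * X 0 * X 1 ^ 3 - C (3 * c₄ ^ 2) * X 1 ^ 4

/-- `𝔠₄(λ,μ) = −(1/(4²·3²)) · |Hessian(𝔇)|` for `n = 3` (`deg 𝔇 = 4`).
[cite: Fisher2012Hessian, §8 (display defining 𝔠₄, deg 𝔇 = 4)] -/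
def hesseC4three (c₄ c₆ : ℚ) : MvPolynomial (Fin 2) ℚ :=
  C (-1 / (4 ^ 2 * 3 ^ 2 : ℚ)) * hessianDet (hesseD3 c₄ c₆)

/-- `𝔠₆(λ,μ) = (1/(4·4)) · |∂𝔇/∂λ, ∂𝔇/∂μ; ∂𝔠₄/∂λ, ∂𝔠₄/∂μ|` for `n = 3` (`deg 𝔇 = deg 𝔠₄ = 4`).
[cite: Fisher2012Hessian, §8 (display defining 𝔠₆)] -/
def hesseC6three (c₄ c₆ : ℚ) : MvPolynomial (Fin 2) ℚ :=
  C (1 / (4 * 4 : ℚ)) * jacobianDet (hesseD3 c₄ c₆) (hesseC4three c₄ c₆)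

/-- The member `E_{λ,μ} : y² = x³ − 27𝔠₄(λ,μ)x − 54𝔠₆(λ,μ)` of the Hesse pencil of
`E : y² = x³ − 27c₄x − 54c₆` for `n = 3` (the family parametrised by `X_E(3) ≅ ℙ¹`), at `(λ, μ) = (l, m)`.
[cite: Fisher2012Hessian, Thm. 13.2 (the family E_{λ,μ}, n = 3)] -/
def hessePencil3 (c₄ c₆ l m : ℚ) : WeierstrassCurve ℚ :=
  ⟨0, 0, 0, -27 * MvPolynomial.eval ![l, m] (hesseC4three c₄ c₆),
    -54 * MvPolynomial.eval ![l, m] (hesseC6three c₄ c₆)⟩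

/-- **Fisher 2012, Theorem 13.2, direction "if", `n = 3`, `K = ℚ`** (formulae of Salmon /
Rubin–Silverberg): every NON-SINGULAR member `E_{λ,μ}` (`λ, μ ∈ ℚ`) of the `n = 3` Hesse pencil of
`E : y² = x³ − 27c₄x − 54c₆` is `3`-congruent to `E` — there is an isomorphism of `Γ_ℚ`-modules
`E_{λ,μ}[3] ≅ E[3]` (print: "directly `3`-congruent"; the Weil-pairing clause is dropped). NAMED FACT,
not proved here. [cite: Fisher2012Hessian, Thm. 13.2 (n = 3, with §8 and Def. 13.1)] -/
def thm132_threeCongruent_hessePencil : Prop :=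
  ∀ (c₄ c₆ l m : ℚ) [(c4c6Model c₄ c₆).IsElliptic] [(hessePencil3 c₄ c₆ l m).IsElliptic],
    ∃ e : geomTorsion (hessePencil3 c₄ c₆ l m) (3 : ℤ) ≃+ geomTorsion (c4c6Model c₄ c₆) (3 : ℤ),
      ∀ (σ : Field.absoluteGaloisGroup ℚ) (P : geomTorsion (hessePencil3 c₄ c₆ l m) (3 : ℤ)),
        e (σ • P) = σ • e P

/-- **Transport of Theorem 13.2 (`n = 3`) to any model.** For every elliptic curve `W/ℚ` and every
non-singular member of the `n = 3` Hesse pencil of its `c₄,c₆`-model, `E_{λ,μ}[3] ≅ W[3]` as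
`Γ_ℚ`-modules. Conditional on the named fact `thm132_threeCongruent_hessePencil`; the transport is
proved. [cite: Fisher2012Hessian, Thm. 13.2] -/
theorem threeCongruent_hessePencil3 (hF : thm132_threeCongruent_hessePencil)
    (W : WeierstrassCurve ℚ) [W.IsElliptic] (l m : ℚ) [(hessePencil3 W.c₄ W.c₆ l m).IsElliptic] :
    ∃ e : geomTorsion (hessePencil3 W.c₄ W.c₆ l m) (3 : ℤ) ≃+ geomTorsion W (3 : ℤ),
      ∀ (σ : Field.absoluteGaloisGroup ℚ) (P : geomTorsion (hessePencil3 W.c₄ W.c₆ l m) (3 : ℤ)),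
        e (σ • P) = σ • e P := by
  obtain ⟨e₁, he₁⟩ := hF W.c₄ W.c₆ l m
  obtain ⟨e₂, he₂⟩ := exists_geomTorsion_addEquiv_c4c6Model W 3
  refine ⟨e₁.trans e₂.symm, fun σ P => ?_⟩
  simp only [AddEquiv.trans_apply]
  apply e₂.injective
  rw [AddEquiv.apply_symm_apply, he₂, AddEquiv.apply_symm_apply, he₁]

end Literature.NumberTheory.EllipticCurves.Fisher2012

end
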